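/-
Copyright (c) 2026 the pub-hodgecm-mathlib formalisation cell (harness21).  Prover seat hodgecm-mathlib-K2E4-p14 (g6), Track B ∕ K2-LIT, h413 =
`stmt-HodgeConjecture-24833`, line `K2_E1_TraceFormulaBeta`, campaign «EIS-WHITTAKER-3», rung «W5₃-FINAL» LAYER 1 (dealer K2E1-plan (g5) 2026-09-04T08:19:17Z; wiring of
record K2E1b-plan (g6) (γ) `WIRING-W5-FINAL-EisWhittaker3` 62273ccaa0f78706 §0; rulings «J4₃ COUPLED» 08:18:30Z, «LETTERS-μD» 08:12:57Z).
-/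
import Summits.HodgeConjecture.HodgeConjecture.Theorems.K2E1SphericalEisensteinContinuationU3        -- ★ W5₃-A p858548 (this seat): `continuation_of_constantTerm_add_holomorphic` (the N-free engine); brings ★ W4
import Summits.HodgeConjecture.HodgeConjecture.Theorems.K2E1MaassSelbergSphericalBracketsCMThree       -- ★ (R6k)₃ p858169∕p858174 (this seat): `intertwinedCoeff_const`; brings ★ (ν-2) `K2E1HeisenbergHaarU3`
import Summits.HodgeConjecture.HodgeConjecture.Theorems.K2E1EisensteinMinusConstantTermPoissonU3       -- ★ W1₃ p. (K2E3-p14 g4): `eisensteinSeriesU_sub_borelConstantTerm_eq_three` :159 (the payer of `hEB`; brings the Heisenberg chart, `adeleFourierCoeff`)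
import Summits.HodgeConjecture.HodgeConjecture.Theorems.K2E1BorelEisensteinGodementCMThree             -- ★ (K2E3 lineage): `exists_locallyUniform_majorant_flatSectionU_cm_three` (Godement, unconditional at CM, `Re z > 2`)
import Summits.HodgeConjecture.HodgeConjecture.Theorems.K2E1EisensteinAnalyticBinders                  -- ★ p857653 (K2E1-p09 g4): `hfin_of_locallyUniformMajorant`
import Summits.HodgeConjecture.HodgeConjecture.Theorems.K2E1BorelCosetsDictionary                      -- ★: `forall_arithmeticBorel_iff`
import Summits.HodgeConjecture.HodgeConjecture.Theorems.K2E1TruncatedEisensteinExplicit                -- ★: `borelHeight_arithmeticBorel_mul`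
import Summits.HodgeConjecture.HodgeConjecture.Theorems.K2E1HeightFunctionU3                           -- ★: `borelHeight_one`
import HarnessLib

/-!
# K2·E1 — `K2E1SphericalEisensteinContinuationU3Final`: THE ASSEMBLY, LAYER 1 — MEROMORPHIC CONTINUATION OF THE SPHERICAL EISENSTEIN SERIES OF `U(2,1)_{L∕L⁺}` TO THE OPEN
# WINDOW `Re z > 1` WITH EXACTLY ONE POLE, SIMPLE, AT `z = 2ρ_H = 2`, RESIDUE `φ₀·r ≠ 0` — MODULO THE CONSTANT-TERM, WHITTAKER AND FOURIER–JACOBI LETTERS ONLY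

Track B ∕ K2-LIT, crux h413 = `stmt-HodgeConjecture-24833`, route of record `HCCMUnconditional`; cell `hodgecm-mathlib`, squad K2, ENGINE E1.  Prover seat `hodgecm-mathlib-K2E4-p14` (g6);
rung «W5₃-FINAL» LAYER 1 of the dealer K2E1-plan (g5) 08:19:17Z (the `N = 3` twin of ★ p858453 `K2E1SphericalEisensteinContinuationU2Final`).  THEOREMS ONLY (no `def`, no `instance`,
no notation, no named-fact hypothesis, no `sorry`); lane `--supports stmt-HodgeConjecture-24833 --as helper` (count-neutral).  Closes no socket.

THE ASSEMBLY ((γ) wiring table §0).  ★ W5₃-A `continuation_of_constantTerm_add_holomorphic` is the `N`-free engine: from `U` open ∋ `a`, a constant-term continuation `c̃` (meromorphic on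
`U`, holomorphic off `a`, `(z−a)c̃ → r`), a remainder `R` holomorphic on `U`, `h > 0` and the expansion `hE : E z = φ₀(h^z + c̃ z·h^{a−z}) + R z` on `U ∩ P`, it delivers (a) holomorphy
off `a`, (a′) meromorphy, (b) `Ẽ = E` on `U ∩ P`, (c) `(z−a)Ẽ → φ₀·r`.  THIS LAYER instantiates, at the CM pair `(L⁺, L)`, `a = 2`, `U = {Re z > 1}`, `P = (2 < Re ·)`:
* `h := H(g)` (★ `borelHeight_pos`), `E z := eisensteinSeriesU (φ₀·H^z) g`;
* the constant term on `Re z > 2` (§1): ★ CT `borelConstantTerm_eisensteinSeriesU_three` (`E_B = f(g) + (ν𝓕)⁻¹·∫ f(w₀vg) dν`; Godement finiteness ★ `hfin_of_locallyUniformMajorant` ∘ ★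
  `exists_locallyUniform_majorant_flatSectionU_cm_three`, `N(𝔸)` inversion-invariant ★ (ν-2), `0 < ν(𝓕) < ∞` ★) and ★ (R6k)₃ `intertwinedCoeff_const` (`∫ φ₀H(w₀vg)^z dν =
  c(z)·φ₀·H(g)^{2−z}`, complex `z`, Iwasawa ★) ⟹ `E_B(g) = φ₀·(H(g)^z + c(z)·H(g)^{2−z})`, `c(z) = (ν𝓕)⁻¹·∫_{N(𝔸)} H(w₀v)^z dν`;
* `R := Σ'_{x₀ ∈ L} Σ'_{η ∈ L⁺} 𝟙_{η≠0} J(z, x₀, η) + Σ'_{ξ ∈ L} 𝟙_{ξ≠0} W(z, ξ)` — the Fourier–Jacobi layer plus the Whittaker layer of ★ W1₃ :159, holomorphic on `U` by the letter `hSJ`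
  (J4₃'s output face (iii), RULING «J4₃ COUPLED») and by ★ W4 `summable_differentiableOn_tsum_of_exp_bounds` with `K := L` from the letters `hWhol hWbd`;
so that the ONLY letters left are: the CONSTANT-TERM CONTINUATION `c r` with `hr hcmer hchol hcres hceq` [payer «W5₃-B» after (q10) FILE 3; shape = ★ W5-B p858422 shifted by one];
the WHITTAKER family `W : ℂ → L → ℂ` with `hWhol hWbd` (★ W4 face, `K := L`) [W2₃ ∕ W3₃ ∕ W-hWbd₃] and its identification `hWeq : W z ξ = μ_E(D_E)⁻¹·𝓕_E[Φ^Z_{g,z}](ξ)` (`ξ ≠ 0`,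
`Re z > 2`; `μ_E(D_E)⁻¹` UNEXPANDED per «LETTERS-μD») [W3₃(-cov)]; the FOURIER–JACOBI family `J : ℂ → L → L⁺ → ℂ` with the summed holomorphy `hSJ` [J4₃ §4 (iii) ∘ J-hJbd₃] and its
identification `hJeq : J z x₀ η = μ_F(D_F)⁻¹·𝓕_F[Φ_{g,z}((x₀)_𝔸, ·)](η)` (`η ≠ 0`, all `x₀`, `Re z > 2`) [J3₃]; and the RAW EXPANSION `hEB : E − E_B = μ_F(D_F)⁻¹·Σ'_{x₀}Σ'_η 𝟙_{η≠0}
𝓕_F[Φ_{g,z}((x₀)_𝔸,·)](η) + μ_E(D_E)⁻¹·Σ'_ξ 𝟙_{ξ≠0} 𝓕_E[Φ^Z_{g,z}](ξ)` on `Re z > 2` = ★ W1₃ :159's conclusion VERBATIM at the flat spherical section, `Φ_{g,z}(X, t) :=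
φ₀H^z(ι(w₀)·heisChart(X, θ(t))·g)`, `Φ^Z_{g,z}(X) := μ_F(D_F)⁻¹·∫ Φ_{g,z}(X, t) dμ_F(t)` [payer «W1₃-SPH» = ★ :159 with its binders discharged; LAYER 2 of this file otherwise].
HEAD **`sphericalEisenstein_continuation_cm_three_of_layers`**: `∃ Ẽ r, r ≠ 0 ∧ MeromorphicOn Ẽ {Re z > 1} ∧ DifferentiableOn ℂ Ẽ ({Re z > 1} ∖ {2}) ∧ (∀ z, 2 < Re z → Ẽ z = E(φ₀H^z)(g))
∧ Tendsto ((z−2)·Ẽ z) (𝓝[≠]2) (𝓝 (φ₀·r))` — «(H4-b)₃-sph: `L²_res ∩ sph = ℂ`» on the OPEN window modulo the letters; **`sphericalEisenstein_continuation_cm_three_of_layers'`** = the (γ) §0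
target bytes (`φ₀ ≠ 0`: `∃ Ẽ, … ∧ ∃ ρ ≠ 0, Tendsto ((z−2)·Ẽ z) (𝓝[≠]2) (𝓝 ρ)`); §1′ **`borelConstantTerm_sphericalEisenstein_cm_three_one`**: the evaluation at `g = 1` (`H(1) = 1`).
HONEST LABEL: HC_CM is proved only modulo the 7 printed citations (2 remaining named inputs: hLiu418 = `stmt-HodgeConjecture-24832`, h413 = `stmt-HodgeConjecture-24833`) until rung 0
closes; this file asserts no named fact and closes no socket; LAYER 1 is conditional by construction on `hr hcmer hchol hcres hceq hWhol hWbd hWeq hSJ hJeq hEB`; the closed axis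
`Re z = 1` (ceiling R7) is NOT claimed.
References: [Garrett2018] §1.10–§1.12, §2.8–§2.11 · [Bump1997] §3.7 · [MoeglinWaldspurger1995] II.1.7, IV.1 · [GelbartPiatetskiShapiro1984] §2 · [Selberg1956] A. Selberg, *Harmonic analysis
and discontinuous groups*, §7.
-/

set_option autoImplicit false
-- the mandated namespace repeats the single-problem summit's segment (`HodgeConjecture.HodgeConjecture`)
set_option linter.dupNamespace false

noncomputable section

open MeasureTheory Measure NumberField NumberField.mixedEmbedding IsDedekindDomain Set Filter Module
open scoped ENNReal NNReal Topology Classical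
open Literature.NumberTheory.Automorphic Literature.NumberTheory.Automorphic.UnitaryGroup AdelicGroupData
open Summit.HodgeConjecture.HodgeConjecture.Cruxes.H413.K2E1BorelEisensteinU
open Summit.HodgeConjecture.HodgeConjecture.Cruxes.H413.K2E1MaassSelbergBracketsThree (measurable_flatSectionU)
open Summit.HodgeConjecture.HodgeConjecture.Cruxes.H413.K2E1SphericalEisensteinContinuationU3 (continuation_of_constantTerm_add_holomorphic)
open Summit.HodgeConjecture.HodgeConjecture.Cruxes.H413.K2E1WhittakerSeriesConvergenceU2 (summable_differentiableOn_tsum_of_exp_bounds)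
open Summit.HodgeConjecture.HodgeConjecture.Cruxes.H413.K2E1MaassSelbergSphericalBracketsCMThree (intertwinedCoeff_const)
open Summit.HodgeConjecture.HodgeConjecture.Cruxes.H413.K2E1EisensteinSeriesLeftRight (borelConstantTerm_eisensteinSeriesU_three)
open Summit.HodgeConjecture.HodgeConjecture.Cruxes.H413.K2E1EisensteinAnalyticBinders (hfin_of_locallyUniformMajorant)
open Summit.HodgeConjecture.HodgeConjecture.Cruxes.H413.K2E1BorelEisensteinGodementCMThree (exists_locallyUniform_majorant_flatSectionU_cm_three)
open Summit.HodgeConjecture.HodgeConjecture.Cruxes.H413.K2E1BorelCosetsDictionary (forall_arithmeticBorel_iff)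
open Summit.HodgeConjecture.HodgeConjecture.Cruxes.H413.K2E1HeisenbergHaarU3 (isInvInvariant_of_isHaarMeasure_adelicUnipotent_three)
open Summit.HodgeConjecture.HodgeConjecture.Cruxes.H413.K2E1HeightFunctionU3 (borelHeight_one)

namespace Summit.HodgeConjecture.HodgeConjecture.Cruxes.H413.K2E1SphericalEisensteinContinuationU3Final

variable (L : Type) [Field L] [NumberField L] [IsCMField L]
variable [MeasurableSpace (quasiSplit (↥(maximalRealSubfield L)) L (IsCMField.complexConj L) 3).Adelic] [BorelSpace (quasiSplit (↥(maximalRealSubfield L)) L (IsCMField.complexConj L) 3).Adelic]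
variable [MeasurableSpace (AdeleRing (𝓞 ↥(maximalRealSubfield L)) ↥(maximalRealSubfield L))] [MeasurableSpace (AdeleRing (𝓞 L) L)]

/-! ## §1 The constant term of the spherical Eisenstein series of `U(2,1)` at the CM pair: `E_B(z, g) = φ₀·(H(g)^z + c(z)·H(g)^{2−z})` on `Re z > 2` -/

omit [MeasurableSpace (AdeleRing (𝓞 ↥(maximalRealSubfield L)) ↥(maximalRealSubfield L))] [MeasurableSpace (AdeleRing (𝓞 L) L)] in
/-- **`E(φ₀H^z)_B(g) = φ₀·H(g)^z + (ν𝓕)⁻¹·(∫_{N(𝔸)} H(w₀v)^z dν)·φ₀·H(g)^{2−z}`** on `Re z > 2` for `U(2,1)` at the CM pair: ★ CT `borelConstantTerm_eisensteinSeriesU_three` (Godement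
finiteness ★ at CM, `N(𝔸)` inversion-invariant ★ (ν-2), `0 < ν(𝓕) < ∞` from the fundamental domain of compact closure) and ★ (R6k)₃ `intertwinedCoeff_const` (`∫ φ₀·H(w₀vg)^z dν =
c(z)·φ₀·H(g)^{2−z}`, complex `z`, Iwasawa ★).  The exponent `2 − z` is `2ρ_H − z` for `U(2,1)`. [cite: MoeglinWaldspurger1995, II.1.7] [cite: Garrett2018, §2.8] -/
theorem borelConstantTerm_sphericalEisenstein_cm_three (ν : Measure ↥(adelicUnipotent (↥(maximalRealSubfield L)) L (IsCMField.complexConj L) 3)) [ν.IsHaarMeasure]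
    {𝓕 : Set ↥(adelicUnipotent (↥(maximalRealSubfield L)) L (IsCMField.complexConj L) 3)} (h𝓕N : IsFundamentalDomain ↥(rationalUnipotent (↥(maximalRealSubfield L)) L (IsCMField.complexConj L) 3) 𝓕 ν) (h𝓕c : IsCompact (closure 𝓕))
    (φ₀ : ℂ) {z : ℂ} (hz : 2 < z.re) (g : (quasiSplit (↥(maximalRealSubfield L)) L (IsCMField.complexConj L) 3).Adelic) :
    borelConstantTerm ν 𝓕 (eisensteinSeriesU (flatSectionU (fun _ : (quasiSplit (↥(maximalRealSubfield L)) L (IsCMField.complexConj L) 3).Adelic => φ₀) z)) g =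
      φ₀ * (((borelHeight g : ℝ) : ℂ) ^ z + ((((ν 𝓕).toReal⁻¹ : ℝ)) : ℂ) * (∫ v : ↥(adelicUnipotent (↥(maximalRealSubfield L)) L (IsCMField.complexConj L) 3), (((borelHeight ((quasiSplit (↥(maximalRealSubfield L)) L (IsCMField.complexConj L) 3).toAdelic (weylLongU ((IsCMField.complexConj L : L ≃ₐ[↥(maximalRealSubfield L)] L) : L →+* L) (rfl : (StdForm.antidiagonal 3).over L = (StdForm.antidiagonal 3).over L)) * (v : (quasiSplit (↥(maximalRealSubfield L)) L (IsCMField.complexConj L) 3).Adelic))) : ℝ) : ℂ) ^ z ∂ν) * ((borelHeight g : ℝ) : ℂ) ^ (2 - z)) := by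
  haveI := t2Space_adeleRing_of_numberField L
  haveI := locallyCompactSpace_adeleRing' L
  haveI : T2Space (quasiSplit (↥(maximalRealSubfield L)) L (IsCMField.complexConj L) 3).Adelic := inferInstanceAs (T2Space (adelic (↥(maximalRealSubfield L)) L (IsCMField.complexConj L) 3 ((StdForm.antidiagonal 3).over L)))
  have hc : IsCMField.complexConj L * IsCMField.complexConj L = 1 := AlgEquiv.ext fun x => IsCMField.complexConj_apply_apply L x
  have hc1 : IsCMField.complexConj L ≠ 1 := IsCMField.complexConj_ne_one L
  haveI : ν.IsInvInvariant := isInvInvariant_of_isHaarMeasure_adelicUnipotent_three hc ν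
  have hBK := exists_mem_borelAdelic_mul_mem_standardMaximalCompactGL_cm_three L
  have h𝓕₀ : ν 𝓕 ≠ 0 := measure_ne_zero_of_isFundamentalDomain_rationalUnipotent ν h𝓕N
  have h𝓕top : ν 𝓕 ≠ ∞ := ((measure_mono subset_closure).trans_lt h𝓕c.measure_lt_top).ne
  -- the flat spherical section: Borel, left-`N(𝔸)`- and `B(L⁺)`-invariant, Godement-finite at `g` (`Re z > 2`)
  have hfm : Measurable (flatSectionU (fun _ : (quasiSplit (↥(maximalRealSubfield L)) L (IsCMField.complexConj L) 3).Adelic => φ₀) z) := measurable_flatSectionU measurable_const z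
  have hfN : ∀ (n : ↥(adelicUnipotent (↥(maximalRealSubfield L)) L (IsCMField.complexConj L) 3)) (y : (quasiSplit (↥(maximalRealSubfield L)) L (IsCMField.complexConj L) 3).Adelic), flatSectionU (fun _ : (quasiSplit (↥(maximalRealSubfield L)) L (IsCMField.complexConj L) 3).Adelic => φ₀) z ((n : (quasiSplit (↥(maximalRealSubfield L)) L (IsCMField.complexConj L) 3).Adelic) * y) = flatSectionU (fun _ : (quasiSplit (↥(maximalRealSubfield L)) L (IsCMField.complexConj L) 3).Adelic => φ₀) z y := fun n y => by
    rw [flatSectionU_apply, flatSectionU_apply, borelHeight_unipotent_mul n.2 y]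
  have hfB : ∀ b ∈ borelU ((IsCMField.complexConj L : L ≃ₐ[↥(maximalRealSubfield L)] L) : L →+* L) ((StdForm.antidiagonal 3).over L), ∀ x : (quasiSplit (↥(maximalRealSubfield L)) L (IsCMField.complexConj L) 3).Adelic,
      flatSectionU (fun _ : (quasiSplit (↥(maximalRealSubfield L)) L (IsCMField.complexConj L) 3).Adelic => φ₀) z ((quasiSplit (↥(maximalRealSubfield L)) L (IsCMField.complexConj L) 3).toAdelic b * x) = flatSectionU (fun _ : (quasiSplit (↥(maximalRealSubfield L)) L (IsCMField.complexConj L) 3).Adelic => φ₀) z x :=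
    forall_arithmeticBorel_iff.1 fun b hb x => by rw [flatSectionU_apply, flatSectionU_apply, K2E1TruncatedEisensteinExplicit.borelHeight_arithmeticBorel_mul hb]
  have hfin := hfin_of_locallyUniformMajorant ν hfB (fun q => (continuous_flatSectionU continuous_const z).comp (continuous_const.mul continuous_id))
    (exists_locallyUniform_majorant_flatSectionU_cm_three L hz (φ := fun _ : (quasiSplit (↥(maximalRealSubfield L)) L (IsCMField.complexConj L) 3).Adelic => φ₀) (M := ‖φ₀‖) (fun x => le_rfl)) h𝓕c g
  rw [borelConstantTerm_eisensteinSeriesU_three ν hfm hfN hfB h𝓕N h𝓕₀ h𝓕top g hfin]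
  -- the intertwining integral: `∫ φ₀H(w₀vg)^z dν = c(z)·φ₀·H(g)^{2−z}` (★ (R6k)₃, complex exponent)
  have hne : ((borelHeight g : ℝ) : ℂ) ≠ 0 := Complex.ofReal_ne_zero.2 (ne_of_gt (by exact_mod_cast borelHeight_pos g))
  have hI := intertwinedCoeff_const hc hc1 ν hBK φ₀ z g
  have hA : ∫ v : ↥(adelicUnipotent (↥(maximalRealSubfield L)) L (IsCMField.complexConj L) 3), flatSectionU (fun _ : (quasiSplit (↥(maximalRealSubfield L)) L (IsCMField.complexConj L) 3).Adelic => φ₀) z ((quasiSplit (↥(maximalRealSubfield L)) L (IsCMField.complexConj L) 3).toAdelic (weylLongU ((IsCMField.complexConj L : L ≃ₐ[↥(maximalRealSubfield L)] L) : L →+* L) (rfl : (StdForm.antidiagonal 3).over L = (StdForm.antidiagonal 3).over L)) * (v : (quasiSplit (↥(maximalRealSubfield L)) L (IsCMField.complexConj L) 3).Adelic) * g) ∂ν = (∫ v : ↥(adelicUnipotent (↥(maximalRealSubfield L)) L (IsCMField.complexConj L) 3), (((borelHeight ((quasiSplit (↥(maximalRealSubfield L)) L (IsCMField.complexConj L)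 3).toAdelic (weylLongU ((IsCMField.complexConj L : L ≃ₐ[↥(maximalRealSubfield L)] L) : L →+* L) (rfl : (StdForm.antidiagonal 3).over L = (StdForm.antidiagonal 3).over L)) * (v : (quasiSplit (↥(maximalRealSubfield L)) L (IsCMField.complexConj L) 3).Adelic))) : ℝ) : ℂ) ^ z ∂ν) * φ₀ * ((borelHeight g : ℝ) : ℂ) ^ (2 - z) := by
    simp_rw [mul_assoc ((quasiSplit (↥(maximalRealSubfield L)) L (IsCMField.complexConj L) 3).toAdelic (weylLongU ((IsCMField.complexConj L : L ≃ₐ[↥(maximalRealSubfield L)] L) : L →+* L) (rfl : (StdForm.antidiagonal 3).over L = (StdForm.antidiagonal 3).over L)))]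
    calc ∫ v : ↥(adelicUnipotent (↥(maximalRealSubfield L)) L (IsCMField.complexConj L) 3), flatSectionU (fun _ : (quasiSplit (↥(maximalRealSubfield L)) L (IsCMField.complexConj L) 3).Adelic => φ₀) z ((quasiSplit (↥(maximalRealSubfield L)) L (IsCMField.complexConj L) 3).toAdelic (weylLongU ((IsCMField.complexConj L : L ≃ₐ[↥(maximalRealSubfield L)] L) : L →+* L) (rfl : (StdForm.antidiagonal 3).over L = (StdForm.antidiagonal 3).over L)) * ((v : (quasiSplit (↥(maximalRealSubfield L)) L (IsCMField.complexConj L) 3).Adelic) * g)) ∂ν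
        = (∫ v : ↥(adelicUnipotent (↥(maximalRealSubfield L)) L (IsCMField.complexConj L) 3), flatSectionU (fun _ : (quasiSplit (↥(maximalRealSubfield L)) L (IsCMField.complexConj L) 3).Adelic => φ₀) z ((quasiSplit (↥(maximalRealSubfield L)) L (IsCMField.complexConj L) 3).toAdelic (weylLongU ((IsCMField.complexConj L : L ≃ₐ[↥(maximalRealSubfield L)] L) : L →+* L) (rfl : (StdForm.antidiagonal 3).over L = (StdForm.antidiagonal 3).over L)) * ((v : (quasiSplit (↥(maximalRealSubfield L)) L (IsCMField.complexConj L) 3).Adelic) * g)) ∂ν) * (((borelHeight g : ℝ) : ℂ) ^ (z - 2) * ((borelHeight g : ℝ) : ℂ) ^ (2 - z)) := by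
          rw [← Complex.cpow_add _ _ hne, show z - 2 + (2 - z) = 0 by ring, Complex.cpow_zero, mul_one]
      _ = _ := by rw [← mul_assoc, hI]
  rw [hA, flatSectionU_apply, Complex.real_smul]
  ring

omit [MeasurableSpace (AdeleRing (𝓞 ↥(maximalRealSubfield L)) ↥(maximalRealSubfield L))] [MeasurableSpace (AdeleRing (𝓞 L) L)] in
/-- **EVALUATION AT `g = 1`** («LETTERS-μD»: one evaluation corollary): `H(1) = 1` (★ `borelHeight_one`), so `E(φ₀H^z)_B(1) = φ₀·(1 + (ν𝓕)⁻¹·∫_{N(𝔸)} H(w₀v)^z dν)` on `Re z > 2` —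
the scalar `c(z) = (ν𝓕)⁻¹·∫ H(w₀v)^z dν` is READ OFF the constant term at the identity. [cite: MoeglinWaldspurger1995, II.1.7] [cite: Garrett2018, §2.8] -/
theorem borelConstantTerm_sphericalEisenstein_cm_three_one (ν : Measure ↥(adelicUnipotent (↥(maximalRealSubfield L)) L (IsCMField.complexConj L) 3)) [ν.IsHaarMeasure]
    {𝓕 : Set ↥(adelicUnipotent (↥(maximalRealSubfield L)) L (IsCMField.complexConj L) 3)} (h𝓕N : IsFundamentalDomain ↥(rationalUnipotent (↥(maximalRealSubfield L)) L (IsCMField.complexConj L) 3) 𝓕 ν) (h𝓕c : IsCompact (closure 𝓕))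
    (φ₀ : ℂ) {z : ℂ} (hz : 2 < z.re) :
    borelConstantTerm ν 𝓕 (eisensteinSeriesU (flatSectionU (fun _ : (quasiSplit (↥(maximalRealSubfield L)) L (IsCMField.complexConj L) 3).Adelic => φ₀) z)) 1 = φ₀ * (1 + ((((ν 𝓕).toReal⁻¹ : ℝ)) : ℂ) * (∫ v : ↥(adelicUnipotent (↥(maximalRealSubfield L)) L (IsCMField.complexConj L) 3), (((borelHeight ((quasiSplit (↥(maximalRealSubfield L)) L (IsCMField.complexConj L) 3).toAdelic (weylLongU ((IsCMField.complexConj L : L ≃ₐ[↥(maximalRealSubfield L)] L) : L →+* L) (rfl : (StdForm.antidiagonal 3).over L = (StdForm.antidiagonal 3).over L)) * (v : (quasiSplit (↥(maximalRealSubfield L)) L (IsCMField.complexConj L) 3).Adelic))) : ℝ) : ℂ) ^ z ∂ν)) := by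
  rw [borelConstantTerm_sphericalEisenstein_cm_three L ν h𝓕N h𝓕c φ₀ hz 1, borelHeight_one, NNReal.coe_one, Complex.ofReal_one, Complex.one_cpow, Complex.one_cpow, mul_one]

/-! ## §2 LAYER 1: «(H4-b)₃-sph» at the CM pair modulo the constant-term, Whittaker and Fourier–Jacobi letters -/

/-- **«(H4-b)₃-sph» AT THE CM PAIR, LAYER 1** — for `δ ∈ L⁻ ∖ 0`, a Haar measure `ν` of the Heisenberg radical `N(𝔸_{L⁺})`, a fundamental domain `𝓕` of `N(L⁺)` with compact closure,
additive Haar measures `μ_F, μ_E` of `𝔸_{L⁺}, 𝔸_L`, `φ₀ : ℂ`, `g ∈ U(J₃)(𝔸)`, and the LETTERS: (CT) `c r` with `r ≠ 0`, `c` meromorphic on `{Re z > 1}`, holomorphic off `z = 2`,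
`(z−2)·c(z) → r`, `c(z) = (ν𝓕)⁻¹·∫ H(w₀v)^z dν` on `Re z > 2` [W5₃-B]; (W) `W : ℂ → L → ℂ` holomorphic on `{Re z > 1}` for `ξ ≠ 0` with ★ W4's local bounds over `K := L` (`hWhol hWbd`)
and `hWeq : W z ξ = μ_E(D_E)⁻¹·𝓕_E[Φ^Z_{g,z}](ξ)` (`ξ ≠ 0`, `Re z > 2`) [W2₃ ∕ W3₃ ∕ W-hWbd₃]; (J) `J : ℂ → L → L⁺ → ℂ` with `hSJ : z ↦ Σ'_{x₀}Σ'_η 𝟙_{η≠0} J z x₀ η` holomorphic on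
`{Re z > 1}` (J4₃ §4 (iii)) and `hJeq : J z x₀ η = μ_F(D_F)⁻¹·𝓕_F[Φ_{g,z}((x₀)_𝔸,·)](η)` (`η ≠ 0`, `Re z > 2`) [J3₃ ∕ J4₃ ∕ J-hJbd₃]; (E) the raw expansion `hEB` = ★ W1₃ :159's conclusion at
the flat spherical section [W1₃-SPH]: THERE ARE `Ẽ : ℂ → ℂ` and `r ≠ 0` with `Ẽ` MEROMORPHIC on `{Re z > 1}`, HOLOMORPHIC off `z = 2`, `Ẽ(z) = E(φ₀H^z)(g)` for `Re z > 2`, and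
`(z − 2)·Ẽ(z) → φ₀·r` (`z → 2`): exactly one pole, simple, at `z = 2ρ_H = 2`, with residue the constant `φ₀·r`, independent of `g` (★ W5₃-A engine ∘ §1 ∘ ★ W4).
[cite: Garrett2018, §1.10–§1.12 and §2.8–§2.11] [cite: Bump1997, §3.7] [cite: MoeglinWaldspurger1995, IV.1] [cite: GelbartPiatetskiShapiro1984, §2] -/
theorem sphericalEisenstein_continuation_cm_three_of_layers (hc : IsCMField.complexConj L * IsCMField.complexConj L = 1)
    {δ : L} (hcδ : IsCMField.complexConj L δ = -δ) (hδ : δ ≠ 0)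
    (ν : Measure ↥(adelicUnipotent (↥(maximalRealSubfield L)) L (IsCMField.complexConj L) 3)) [ν.IsHaarMeasure] {𝓕 : Set ↥(adelicUnipotent (↥(maximalRealSubfield L)) L (IsCMField.complexConj L) 3)} (h𝓕N : IsFundamentalDomain ↥(rationalUnipotent (↥(maximalRealSubfield L)) L (IsCMField.complexConj L) 3) 𝓕 ν) (h𝓕c : IsCompact (closure 𝓕))
    (μF : Measure (AdeleRing (𝓞 ↥(maximalRealSubfield L)) ↥(maximalRealSubfield L))) [μF.IsAddHaarMeasure] (μE : Measure (AdeleRing (𝓞 L) L)) [μE.IsAddHaarMeasure]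
    (φ₀ : ℂ) (g : (quasiSplit (↥(maximalRealSubfield L)) L (IsCMField.complexConj L) 3).Adelic)
    (c : ℂ → ℂ) (r : ℂ) (hr : r ≠ 0) (hcmer : MeromorphicOn c {z : ℂ | 1 < z.re}) (hchol : DifferentiableOn ℂ c ({z : ℂ | 1 < z.re} \ {2}))
    (hcres : Tendsto (fun z : ℂ => (z - 2) * c z) (𝓝[≠] 2) (𝓝 r))
    (hceq : ∀ z : ℂ, 2 < z.re → c z = ((((ν 𝓕).toReal⁻¹ : ℝ)) : ℂ) * ∫ v : ↥(adelicUnipotent (↥(maximalRealSubfield L)) L (IsCMField.complexConj L) 3), (((borelHeight ((quasiSplit (↥(maximalRealSubfield L)) L (IsCMField.complexConj L) 3).toAdelic (weylLongU ((IsCMField.complexConj L : L ≃ₐ[↥(maximalRealSubfield L)] L) : L →+* L) (rfl : (StdForm.antidiagonal 3).over L = (StdForm.antidiagonal 3).over L)) * (v : (quasiSplit (↥(maximalRealSubfield L)) L (IsCMField.complexConj L) 3).Adelic))) : ℝ) : ℂ) ^ z ∂ν)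
    (W : ℂ → L → ℂ) (hWhol : ∀ ξ : L, ξ ≠ 0 → DifferentiableOn ℂ (fun z => W z ξ) {z : ℂ | 1 < z.re})
    (hWbd : ∀ z₀ ∈ {z : ℂ | 1 < z.re}, ∃ V ∈ 𝓝 z₀, ∃ (M b a : ℝ) (Cf : Set (FiniteAdeleRing (𝓞 L) L)), 0 ≤ M ∧ 0 < b ∧ IsCompact Cf ∧
      ∀ z ∈ V, ∀ ξ : L,
        ‖W z ξ‖ ≤ M * Real.exp (-(b * ‖InfiniteAdeleRing.ringEquiv_mixedSpace L (algebraMap L (AdeleRing (𝓞 L) L) ξ).1‖)) *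
          (1 + ‖InfiniteAdeleRing.ringEquiv_mixedSpace L (algebraMap L (AdeleRing (𝓞 L) L) ξ).1‖) ^ a ∧
        ((algebraMap L (AdeleRing (𝓞 L) L) ξ).2 ∉ Cf → W z ξ = 0))
    (hWeq : ∀ z : ℂ, 2 < z.re → ∀ ξ : L, ξ ≠ 0 → W z ξ = ((μE (adeleFundamentalDomain L)).toReal⁻¹ : ℂ) * adeleFourierCoeff μE (fun X : AdeleRing (𝓞 L) L => ((μF (adeleFundamentalDomain ↥(maximalRealSubfield L))).toReal⁻¹ : ℂ) * ∫ t : AdeleRing (𝓞 ↥(maximalRealSubfield L)) ↥(maximalRealSubfield L), flatSectionU (fun _ : (quasiSplit (↥(maximalRealSubfield L)) L (IsCMField.complexConj L) 3).Adelic => φ₀) z ((quasiSplit (↥(maximalRealSubfield L)) L (IsCMField.complexConj L) 3).toAdelic (weylLongU ((IsCMField.complexConj L : L ≃ₐ[↥(maximalRealSubfield L)] L) : L →+* L) (rfl : (StdForm.antidiagonal 3).over L = (StdForm.antidiagonal 3).over L)) * ((heisChart hc (X, traceZeroLine ↥(maximalRealSubfield L) L (IsCMField.complexConj L) hcδ hδ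 t) : ↥(adelicUnipotent (↥(maximalRealSubfield L)) L (IsCMField.complexConj L) 3)) : (quasiSplit (↥(maximalRealSubfield L)) L (IsCMField.complexConj L) 3).Adelic) * g) ∂μF) ξ)
    (J : ℂ → L → ↥(maximalRealSubfield L) → ℂ) (hSJ : DifferentiableOn ℂ (fun z => ∑' x₀ : L, ∑' η : ↥(maximalRealSubfield L), ({0}ᶜ : Set ↥(maximalRealSubfield L)).indicator (J z x₀) η) {z : ℂ | 1 < z.re})
    (hJeq : ∀ z : ℂ, 2 < z.re → ∀ (x₀ : L) (η : ↥(maximalRealSubfield L)), η ≠ 0 → J z x₀ η = ((μF (adeleFundamentalDomain ↥(maximalRealSubfield L))).toReal⁻¹ : ℂ) * adeleFourierCoeff μF (fun t : AdeleRing (𝓞 ↥(maximalRealSubfield L)) ↥(maximalRealSubfield L) => flatSectionU (fun _ : (quasiSplit (↥(maximalRealSubfield L)) L (IsCMField.complexConj L) 3).Adelic => φ₀) z ((quasiSplit (↥(maximalRealSubfield L)) L (IsCMField.complexConj L) 3).toAdelic (weylLongU ((IsCMField.complexConj L : L ≃ₐ[↥(maximalRealSubfield L)] L) : L →+* L) (rfl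 : (StdForm.antidiagonal 3).over L = (StdForm.antidiagonal 3).over L)) * ((heisChart hc (algebraMap L (AdeleRing (𝓞 L) L) x₀, traceZeroLine ↥(maximalRealSubfield L) L (IsCMField.complexConj L) hcδ hδ t) : ↥(adelicUnipotent (↥(maximalRealSubfield L)) L (IsCMField.complexConj L) 3)) : (quasiSplit (↥(maximalRealSubfield L)) L (IsCMField.complexConj L) 3).Adelic) * g)) η)
    (hEB : ∀ z : ℂ, 2 < z.re →
      eisensteinSeriesU (flatSectionU (fun _ : (quasiSplit (↥(maximalRealSubfield L)) L (IsCMField.complexConj L) 3).Adelic => φ₀) z) g - borelConstantTerm ν 𝓕 (eisensteinSeriesU (flatSectionU (fun _ : (quasiSplit (↥(maximalRealSubfield L)) L (IsCMField.complexConj L) 3).Adelic => φ₀) z)) g =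
        ((μF (adeleFundamentalDomain ↥(maximalRealSubfield L))).toReal⁻¹ : ℂ) * ∑' x₀ : L, ∑' η : ↥(maximalRealSubfield L), ({0}ᶜ : Set ↥(maximalRealSubfield L)).indicator (adeleFourierCoeff μF (fun t : AdeleRing (𝓞 ↥(maximalRealSubfield L)) ↥(maximalRealSubfield L) => flatSectionU (fun _ : (quasiSplit (↥(maximalRealSubfield L)) L (IsCMField.complexConj L) 3).Adelic => φ₀) z ((quasiSplit (↥(maximalRealSubfield L)) L (IsCMField.complexConj L) 3).toAdelic (weylLongU ((IsCMField.complexConj L : L ≃ₐ[↥(maximalRealSubfield L)] L) : L →+* L) (rfl : (StdForm.antidiagonal 3).over L = (StdForm.antidiagonal 3).over L)) * ((heisChart hc (algebraMap L (AdeleRing (𝓞 L) L) x₀, traceZeroLine ↥(maximalRealSubfield L) L (IsCMField.complexConj L) hcδ hδ t) : ↥(adelicUnipotent (↥(maximalRealSubfield L)) L (IsCMField.complexConj L) 3)) : (quasiSplit (↥(maximalRealSubfield L)) L (IsCMField.complexConj L) 3).Adelic) * g))) η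
        + ((μE (adeleFundamentalDomain L)).toReal⁻¹ : ℂ) * ∑' ξ : L, ({0}ᶜ : Set L).indicator (adeleFourierCoeff μE (fun X : AdeleRing (𝓞 L) L => ((μF (adeleFundamentalDomain ↥(maximalRealSubfield L))).toReal⁻¹ : ℂ) * ∫ t : AdeleRing (𝓞 ↥(maximalRealSubfield L)) ↥(maximalRealSubfield L), flatSectionU (fun _ : (quasiSplit (↥(maximalRealSubfield L)) L (IsCMField.complexConj L) 3).Adelic => φ₀) z ((quasiSplit (↥(maximalRealSubfield L)) L (IsCMField.complexConj L) 3).toAdelic (weylLongU ((IsCMField.complexConj L : L ≃ₐ[↥(maximalRealSubfield L)] L) : L →+* L) (rfl : (StdForm.antidiagonal 3).over L = (StdForm.antidiagonal 3).over L)) * ((heisChart hc (X, traceZeroLine ↥(maximalRealSubfield L) L (IsCMField.complexConj L) hcδ hδ t) : ↥(adelicUnipotent (↥(maximalRealSubfield L)) L (IsCMField.complexConj L) 3)) : (quasiSplit (↥(maximalRealSubfield L)) L (IsCMField.complexConj L) 3).Adelic) * g) ∂μF)) ξ) :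
    ∃ (Ec : ℂ → ℂ) (r : ℂ), r ≠ 0 ∧ MeromorphicOn Ec {z : ℂ | 1 < z.re} ∧ DifferentiableOn ℂ Ec ({z : ℂ | 1 < z.re} \ {2}) ∧
      (∀ z : ℂ, 2 < z.re → Ec z = eisensteinSeriesU (flatSectionU (fun _ : (quasiSplit (↥(maximalRealSubfield L)) L (IsCMField.complexConj L) 3).Adelic => φ₀) z) g) ∧
      Tendsto (fun z : ℂ => (z - 2) * Ec z) (𝓝[≠] 2) (𝓝 (φ₀ * r)) := by
  have hU : IsOpen {z : ℂ | 1 < z.re} := isOpen_lt continuous_const Complex.continuous_re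
  have h2U : (2 : ℂ) ∈ {z : ℂ | 1 < z.re} := by
    show (1 : ℝ) < (2 : ℂ).re
    norm_num
  have hh : (0 : ℝ) < (borelHeight g : ℝ) := by exact_mod_cast borelHeight_pos g
  -- the two layers with the `μ(D)⁻¹` letters pushed inside and the coefficients identified (`hJeq`, `hWeq`)
  have hFJ : ∀ z : ℂ, 2 < z.re →
      eisensteinSeriesU (flatSectionU (fun _ : (quasiSplit (↥(maximalRealSubfield L)) L (IsCMField.complexConj L) 3).Adelic => φ₀) z) g - borelConstantTerm ν 𝓕 (eisensteinSeriesU (flatSectionU (fun _ : (quasiSplit (↥(maximalRealSubfield L)) L (IsCMField.complexConj L) 3).Adelic => φ₀) z)) g =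
        ∑' x₀ : L, ∑' η : ↥(maximalRealSubfield L), ({0}ᶜ : Set ↥(maximalRealSubfield L)).indicator (J z x₀) η + ∑' ξ : L, ({0}ᶜ : Set L).indicator (fun ξ => W z ξ) ξ := by
    intro z hz
    rw [hEB z hz, ← tsum_mul_left, ← tsum_mul_left]
    congr 1
    · refine tsum_congr fun x₀ => ?_
      rw [← tsum_mul_left]
      refine tsum_congr fun η => ?_
      by_cases hη : η = 0
      · rw [indicator_of_notMem (show η ∉ ({0}ᶜ : Set ↥(maximalRealSubfield L)) from fun h => h hη), indicator_of_notMem (show η ∉ ({0}ᶜ : Set ↥(maximalRealSubfield L)) from fun h => h hη), mul_zero]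
      · rw [indicator_of_mem (show η ∈ ({0}ᶜ : Set ↥(maximalRealSubfield L)) from hη), indicator_of_mem (show η ∈ ({0}ᶜ : Set ↥(maximalRealSubfield L)) from hη), hJeq z hz x₀ η hη]
    · refine tsum_congr fun ξ => ?_
      by_cases hξ : ξ = 0
      · rw [indicator_of_notMem (show ξ ∉ ({0}ᶜ : Set L) from fun h => h hξ), indicator_of_notMem (show ξ ∉ ({0}ᶜ : Set L) from fun h => h hξ), mul_zero]
      · rw [indicator_of_mem (show ξ ∈ ({0}ᶜ : Set L) from hξ), indicator_of_mem (show ξ ∈ ({0}ᶜ : Set L) from hξ), hWeq z hz ξ hξ]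
  -- the remainder `R := S_J + S_W` is holomorphic on `{Re z > 1}` (letter `hSJ`; ★ W4 BY NAME with `K := L`)
  obtain ⟨-, -, hSW⟩ := summable_differentiableOn_tsum_of_exp_bounds L hU hWhol hWbd
  have hR : DifferentiableOn ℂ (fun z => ∑' x₀ : L, ∑' η : ↥(maximalRealSubfield L), ({0}ᶜ : Set ↥(maximalRealSubfield L)).indicator (J z x₀) η + ∑' ξ : L, ({0}ᶜ : Set L).indicator (fun ξ => W z ξ) ξ) {z : ℂ | 1 < z.re} :=
    hSJ.add hSW
  -- the expansion `hE` on `Re z > 2`: §1 (constant term) + the two layers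
  have hE : ∀ z ∈ {z : ℂ | 1 < z.re}, 2 < z.re →
      eisensteinSeriesU (flatSectionU (fun _ : (quasiSplit (↥(maximalRealSubfield L)) L (IsCMField.complexConj L) 3).Adelic => φ₀) z) g =
        φ₀ * ((((borelHeight g : ℝ) : ℝ) : ℂ) ^ z + c z * (((borelHeight g : ℝ) : ℝ) : ℂ) ^ (2 - z)) +
          (∑' x₀ : L, ∑' η : ↥(maximalRealSubfield L), ({0}ᶜ : Set ↥(maximalRealSubfield L)).indicator (J z x₀) η + ∑' ξ : L, ({0}ᶜ : Set L).indicator (fun ξ => W z ξ) ξ) := by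
    intro z _ hz
    rw [← hFJ z hz, hceq z hz, borelConstantTerm_sphericalEisenstein_cm_three L ν h𝓕N h𝓕c φ₀ hz g]
    ring
  obtain ⟨ha, ha', hb, hlim⟩ := continuation_of_constantTerm_add_holomorphic hU h2U hcmer hchol hcres φ₀ hh hR (P := fun z => 2 < z.re) hE
  exact ⟨_, r, hr, ha', ha, fun z hz => hb z (show (1 : ℝ) < z.re by linarith) hz, hlim⟩

/-- **«(H4-b)₃-sph» AT THE CM PAIR, LAYER 1 — THE (γ) §0 TARGET BYTES**: for `φ₀ ≠ 0`, under the same letters, `∃ Ẽ, MeromorphicOn Ẽ {Re z > 1} ∧ DifferentiableOn ℂ Ẽ ({Re z > 1} ∖ {2})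
∧ (∀ z, 2 < Re z → Ẽ z = E(φ₀H^z)(g)) ∧ ∃ ρ ≠ 0, (z−2)·Ẽ z → ρ` (`ρ = φ₀·r`). [cite: Garrett2018, §1.10–§1.12 and §2.8–§2.11] [cite: MoeglinWaldspurger1995, IV.1] -/
theorem sphericalEisenstein_continuation_cm_three_of_layers' (hc : IsCMField.complexConj L * IsCMField.complexConj L = 1)
    {δ : L} (hcδ : IsCMField.complexConj L δ = -δ) (hδ : δ ≠ 0)
    (ν : Measure ↥(adelicUnipotent (↥(maximalRealSubfield L)) L (IsCMField.complexConj L) 3)) [ν.IsHaarMeasure] {𝓕 : Set ↥(adelicUnipotent (↥(maximalRealSubfield L)) L (IsCMField.complexConj L) 3)} (h𝓕N : IsFundamentalDomain ↥(rationalUnipotent (↥(maximalRealSubfield L)) L (IsCMField.complexConj L) 3) 𝓕 ν) (h𝓕c : IsCompact (closure 𝓕))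
    (μF : Measure (AdeleRing (𝓞 ↥(maximalRealSubfield L)) ↥(maximalRealSubfield L))) [μF.IsAddHaarMeasure] (μE : Measure (AdeleRing (𝓞 L) L)) [μE.IsAddHaarMeasure]
    {φ₀ : ℂ} (hφ₀ : φ₀ ≠ 0) (g : (quasiSplit (↥(maximalRealSubfield L)) L (IsCMField.complexConj L) 3).Adelic)
    (c : ℂ → ℂ) (r : ℂ) (hr : r ≠ 0) (hcmer : MeromorphicOn c {z : ℂ | 1 < z.re}) (hchol : DifferentiableOn ℂ c ({z : ℂ | 1 < z.re} \ {2}))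
    (hcres : Tendsto (fun z : ℂ => (z - 2) * c z) (𝓝[≠] 2) (𝓝 r))
    (hceq : ∀ z : ℂ, 2 < z.re → c z = ((((ν 𝓕).toReal⁻¹ : ℝ)) : ℂ) * ∫ v : ↥(adelicUnipotent (↥(maximalRealSubfield L)) L (IsCMField.complexConj L) 3), (((borelHeight ((quasiSplit (↥(maximalRealSubfield L)) L (IsCMField.complexConj L) 3).toAdelic (weylLongU ((IsCMField.complexConj L : L ≃ₐ[↥(maximalRealSubfield L)] L) : L →+* L) (rfl : (StdForm.antidiagonal 3).over L = (StdForm.antidiagonal 3).over L)) * (v : (quasiSplit (↥(maximalRealSubfield L)) L (IsCMField.complexConj L) 3).Adelic))) : ℝ) : ℂ) ^ z ∂ν)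
    (W : ℂ → L → ℂ) (hWhol : ∀ ξ : L, ξ ≠ 0 → DifferentiableOn ℂ (fun z => W z ξ) {z : ℂ | 1 < z.re})
    (hWbd : ∀ z₀ ∈ {z : ℂ | 1 < z.re}, ∃ V ∈ 𝓝 z₀, ∃ (M b a : ℝ) (Cf : Set (FiniteAdeleRing (𝓞 L) L)), 0 ≤ M ∧ 0 < b ∧ IsCompact Cf ∧
      ∀ z ∈ V, ∀ ξ : L,
        ‖W z ξ‖ ≤ M * Real.exp (-(b * ‖InfiniteAdeleRing.ringEquiv_mixedSpace L (algebraMap L (AdeleRing (𝓞 L) L) ξ).1‖)) *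
          (1 + ‖InfiniteAdeleRing.ringEquiv_mixedSpace L (algebraMap L (AdeleRing (𝓞 L) L) ξ).1‖) ^ a ∧
        ((algebraMap L (AdeleRing (𝓞 L) L) ξ).2 ∉ Cf → W z ξ = 0))
    (hWeq : ∀ z : ℂ, 2 < z.re → ∀ ξ : L, ξ ≠ 0 → W z ξ = ((μE (adeleFundamentalDomain L)).toReal⁻¹ : ℂ) * adeleFourierCoeff μE (fun X : AdeleRing (𝓞 L) L => ((μF (adeleFundamentalDomain ↥(maximalRealSubfield L))).toReal⁻¹ : ℂ) * ∫ t : AdeleRing (𝓞 ↥(maximalRealSubfield L)) ↥(maximalRealSubfield L), flatSectionU (fun _ : (quasiSplit (↥(maximalRealSubfield L)) L (IsCMField.complexConj L) 3).Adelic => φ₀) z ((quasiSplit (↥(maximalRealSubfield L)) L (IsCMField.complexConj L) 3).toAdelic (weylLongU ((IsCMField.complexConj L : L ≃ₐ[↥(maximalRealSubfield L)] L) : L →+* L) (rfl : (StdForm.antidiagonal 3).over L = (StdForm.antidiagonal 3).over L)) * ((heisChart hc (X, traceZeroLine ↥(maximalRealSubfield L) L (IsCMField.complexConj L) hcδ hδ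 t) : ↥(adelicUnipotent (↥(maximalRealSubfield L)) L (IsCMField.complexConj L) 3)) : (quasiSplit (↥(maximalRealSubfield L)) L (IsCMField.complexConj L) 3).Adelic) * g) ∂μF) ξ)
    (J : ℂ → L → ↥(maximalRealSubfield L) → ℂ) (hSJ : DifferentiableOn ℂ (fun z => ∑' x₀ : L, ∑' η : ↥(maximalRealSubfield L), ({0}ᶜ : Set ↥(maximalRealSubfield L)).indicator (J z x₀) η) {z : ℂ | 1 < z.re})
    (hJeq : ∀ z : ℂ, 2 < z.re → ∀ (x₀ : L) (η : ↥(maximalRealSubfield L)), η ≠ 0 → J z x₀ η = ((μF (adeleFundamentalDomain ↥(maximalRealSubfield L))).toReal⁻¹ : ℂ) * adeleFourierCoeff μF (fun t : AdeleRing (𝓞 ↥(maximalRealSubfield L)) ↥(maximalRealSubfield L) => flatSectionU (fun _ : (quasiSplit (↥(maximalRealSubfield L)) L (IsCMField.complexConj L) 3).Adelic => φ₀) z ((quasiSplit (↥(maximalRealSubfield L)) L (IsCMField.complexConj L) 3).toAdelic (weylLongU ((IsCMField.complexConj L : L ≃ₐ[↥(maximalRealSubfield L)] L) : L →+* L) (rfl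 : (StdForm.antidiagonal 3).over L = (StdForm.antidiagonal 3).over L)) * ((heisChart hc (algebraMap L (AdeleRing (𝓞 L) L) x₀, traceZeroLine ↥(maximalRealSubfield L) L (IsCMField.complexConj L) hcδ hδ t) : ↥(adelicUnipotent (↥(maximalRealSubfield L)) L (IsCMField.complexConj L) 3)) : (quasiSplit (↥(maximalRealSubfield L)) L (IsCMField.complexConj L) 3).Adelic) * g)) η)
    (hEB : ∀ z : ℂ, 2 < z.re →
      eisensteinSeriesU (flatSectionU (fun _ : (quasiSplit (↥(maximalRealSubfield L)) L (IsCMField.complexConj L) 3).Adelic => φ₀) z) g - borelConstantTerm ν 𝓕 (eisensteinSeriesU (flatSectionU (fun _ : (quasiSplit (↥(maximalRealSubfield L)) L (IsCMField.complexConj L) 3).Adelic => φ₀) z)) g =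
        ((μF (adeleFundamentalDomain ↥(maximalRealSubfield L))).toReal⁻¹ : ℂ) * ∑' x₀ : L, ∑' η : ↥(maximalRealSubfield L), ({0}ᶜ : Set ↥(maximalRealSubfield L)).indicator (adeleFourierCoeff μF (fun t : AdeleRing (𝓞 ↥(maximalRealSubfield L)) ↥(maximalRealSubfield L) => flatSectionU (fun _ : (quasiSplit (↥(maximalRealSubfield L)) L (IsCMField.complexConj L) 3).Adelic => φ₀) z ((quasiSplit (↥(maximalRealSubfield L)) L (IsCMField.complexConj L) 3).toAdelic (weylLongU ((IsCMField.complexConj L : L ≃ₐ[↥(maximalRealSubfield L)] L) : L →+* L) (rfl : (StdForm.antidiagonal 3).over L = (StdForm.antidiagonal 3).over L)) * ((heisChart hc (algebraMap L (AdeleRing (𝓞 L) L) x₀, traceZeroLine ↥(maximalRealSubfield L) L (IsCMField.complexConj L) hcδ hδ t) : ↥(adelicUnipotent (↥(maximalRealSubfield L)) L (IsCMField.complexConj L) 3)) : (quasiSplit (↥(maximalRealSubfield L)) L (IsCMField.complexConj L) 3).Adelic) * g))) η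
        + ((μE (adeleFundamentalDomain L)).toReal⁻¹ : ℂ) * ∑' ξ : L, ({0}ᶜ : Set L).indicator (adeleFourierCoeff μE (fun X : AdeleRing (𝓞 L) L => ((μF (adeleFundamentalDomain ↥(maximalRealSubfield L))).toReal⁻¹ : ℂ) * ∫ t : AdeleRing (𝓞 ↥(maximalRealSubfield L)) ↥(maximalRealSubfield L), flatSectionU (fun _ : (quasiSplit (↥(maximalRealSubfield L)) L (IsCMField.complexConj L) 3).Adelic => φ₀) z ((quasiSplit (↥(maximalRealSubfield L)) L (IsCMField.complexConj L) 3).toAdelic (weylLongU ((IsCMField.complexConj L : L ≃ₐ[↥(maximalRealSubfield L)] L) : L →+* L) (rfl : (StdForm.antidiagonal 3).over L = (StdForm.antidiagonal 3).over L)) * ((heisChart hc (X, traceZeroLine ↥(maximalRealSubfield L) L (IsCMField.complexConj L) hcδ hδ t) : ↥(adelicUnipotent (↥(maximalRealSubfield L)) L (IsCMField.complexConj L) 3)) : (quasiSplit (↥(maximalRealSubfield L)) L (IsCMField.complexConj L) 3).Adelic) * g) ∂μF)) ξ) :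
    ∃ Ec : ℂ → ℂ, MeromorphicOn Ec {z : ℂ | 1 < z.re} ∧ DifferentiableOn ℂ Ec ({z : ℂ | 1 < z.re} \ {2}) ∧
      (∀ z : ℂ, 2 < z.re → Ec z = eisensteinSeriesU (flatSectionU (fun _ : (quasiSplit (↥(maximalRealSubfield L)) L (IsCMField.complexConj L) 3).Adelic => φ₀) z) g) ∧
      ∃ ρ : ℂ, ρ ≠ 0 ∧ Tendsto (fun z : ℂ => (z - 2) * Ec z) (𝓝[≠] 2) (𝓝 ρ) := by
  obtain ⟨Ec, r', hr', ha', ha, hb, hlim⟩ := sphericalEisenstein_continuation_cm_three_of_layers L hc hcδ hδ ν h𝓕N h𝓕c μF μE φ₀ g c r hr hcmer hchol hcres hceq W hWhol hWbd hWeq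
    J hSJ hJeq hEB
  exact ⟨Ec, ha', ha, hb, φ₀ * r', mul_ne_zero hφ₀ hr', hlim⟩

end Summit.HodgeConjecture.HodgeConjecture.Cruxes.H413.K2E1SphericalEisensteinContinuationU3Final

end
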